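import Summits.QuantumFields.BalabanUV.T4Continuum.Support.NE9EvalChannelCouplingModulus
import Summits.QuantumFields.BalabanUV.T4Continuum.Support.NE9MarginalProjection

/-!
# NE9EvalChannelCouplingModulusProj — the CHANNEL COUPLING MODULUS `hTcup` on the owner's v1.3 dictionary `T := 𝒯 ∘ P`
(`NE9MarginalProjection.compProj` ∕ `margProj`, skeleton C5) for an EVALUATION–INTEGRAL channel (cell `pub-balaban`, T4-DAG §2
node U3 ∕ §6 NE9; NE9 formalisation swarm, unit `b2b-balaban-t4-ne9-formalise-leaf-03` gen 3; sibling of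
`NE9EvalChannelCouplingModulus`; skeleton `HOME/t4/b2b-balaban-t4-ne9-p1/SKELETON-NE9-P1.md` v1.3.3 rows A3 ∕ RO ∕ AW ∕ MP, C5)

HONEST FRAMING (T4-DAG PAGE 1).  Rung (B)+1 on a FIXED finite torus — NOT infinite volume, NOT a mass gap, NOT the Clay
problem.  NE9 is a cell NEW ESTIMATE, NOT PRINTED, NOT discharged here.  Bookkeeping over the ABSTRACT carriers of
`T4OutputRate`, the co-owner's `NE9EvaluationChannel.evalChannel` and the owner's projection STRUCTURE `NE9MarginalProjection`;
every analytic input is a DISPLAYED binder stated INLINE (no Prop-valued definition; trigger c3).  [I] = [Balaban1987RG1],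
[II] = [Balaban1988RG2Cluster] are quoted for TYPES only (ABSOLUTE RULE).  `FlowStep.BetaPertH`, (B), (B^μ) do not occur.

WHERE THIS SITS.  After the owner's located correction O-ne9p1g22-1 (skeleton v1.3, C5) the frame's channel is `T := 𝒯 ∘ P`:
the channel `𝒯` (localized curly bracket (1.33) p. 9 of [II], on MARGINAL-FREE inputs) fed with the PROJECTED old terms
`P (E g)`, `P = margProj r A` re-attaching the coupling-renormalization counterterm of (1.3) p. 260 of [I] through node U2's
read-out `r` ((1.20)–(1.22) p. 264) along the marginal direction `A` (the one-cube Wilson action).  The END faces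
`NE9MarginalProjectionEnd.…_compProj` ∕ `…_margProj` display `hTcup` for THIS `T`.  The sibling
`NE9EvalChannelCouplingModulus.channelCouplingModulus_eval` derives `hTcup` for an evaluation–integral channel with coupling-free
kernel and coupling-shifted backgrounds reading ANY history-indexed family with a uniform background modulus.  THIS FILE:
(§1) at `H g := P (E g)` that IS the `hTcup` clause of `compProj (evalChannel …) P` (definitionally); (§2) for `P = margProj r A`
the projected family's background modulus is `CUbar + cr·Nbar·aL` — the read-out coefficient `r_j(E g↾j)` does not depend on
the background, so `margProj r A (E g) U X − margProj r A (E g) U′ X = (E g U X − E g U′ X) − r_j(E g↾j)·(A U X − A U′ X)` — from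
the terms' modulus `CUbar` (`LipBackground`-type, displayed), node U2's read-out size `ReadSize Adm r κ cr` (binder RO) on the
size profile `TermSize E W κ N` (`N j ≤ Nbar`), and a displayed background modulus `aL` of `A` (the one-cube Wilson action is
analytic, in particular Lipschitz, in the background on the domains (1.11)–(1.14) p. 262 of [I] — elementary, WITH the model
O-NE9-1, like row AW; asserted nowhere here); integrability of the projected family along the evaluation families from that
of the terms and of `A`.  NOT PRINTED and not claimed: anything about Bałaban's (1.33) or (1.20); instance rows O-NE9-5 ∕ (w8) ∕
(w9) stay gated on O-NE9-1.  DISGUISE TEST: last coupling only, same old terms; a property of a LINEAR channel and a LINEAR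
projection; no history; not NE9.

WHAT IS PROVED (kernel, `[folklore]`; 0 sorry, 0 `def`).
§1 `channelCouplingModulus_eval_compProj`.
§2 `lipFamily_margProj`, `evalAdm_margProj`, **`channelCouplingModulus_eval_margProj`** (`qT k := (CUbar + cr·Nbar·aL)·qA k`).

References (TYPES only): [Balaban1987RG1] CMP 109 (1987) (1.3) p. 260, (1.11)–(1.14) p. 262, (1.18) p. 263, (1.20)–(1.22)
p. 264, (2.12)–(2.13) p. 268; [Balaban1988RG2Cluster] CMP 116 (1988) (1.24) p. 7, (1.33) p. 9.
-/

noncomputable section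

namespace Summit.QuantumFields.BalabanUV.T4Continuum.NE9EvalChannelCouplingModulusProj

open scoped BigOperators
open MeasureTheory
open Literature.MathematicalPhysics.QuantumFieldTheory.Balaban1983to89
open Literature.MathematicalPhysics.QuantumFieldTheory.Balaban1983to89.T4OutputRate
open Literature.MathematicalPhysics.QuantumFieldTheory.Balaban1983to89.T4HistoryLipschitzRecursion
open Literature.MathematicalPhysics.QuantumFieldTheory.Balaban1983to89.T4HistoryLipschitzSegment
open Summit.QuantumFields.BalabanUV.T4Continuum.NE9EvaluationChannel
open Summit.QuantumFields.BalabanUV.T4Continuum.NE9MarginalProjection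
open Summit.QuantumFields.BalabanUV.T4Continuum.NE9EvalChannelCouplingModulus

variable {C : Carriers} {Bg ι : Type} {Ω : Type*} [MeasurableSpace Ω]

/-! ## §1 `hTcup` for the channel fed with projected old terms -/
/-- **`hTcup` FOR `compProj (evalChannel …) P` (kernel).**  The channel fed with the PROJECTED old terms
(`NE9MarginalProjection.compProj`, skeleton C5: counterterm re-attached through the read-out) satisfies the END's `hTcup`
clause as soon as the projected family `P (E g)` is integrable along the evaluation families and has a uniform background
modulus `CPbar` — §1 at `H g := P (E g)`. [folklore] -/
theorem channelCouplingModulus_eval_compProj {E : Functional C Bg} {W : Set (ℕ → ℝ)}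
    {P : (Bg → C.Dom → ℝ) → (Bg → C.Dom → ℝ)}
    {F₀ : ℕ → ι → Finset C.Dom} {ν₀ : ℕ → ι → C.Dom → Measure Ω} {w₀ : ℕ → ι → C.Dom → Ω → ℝ}
    {bg : ℕ → (ℕ → ℝ) → ι → C.Dom → Ω → Bg} (gauge : Bg → Bg → ℝ) {amp : ℕ → ι → C.Dom → Ω → ℝ}
    {κ CPbar : ℝ} {wt : ℕ → ι → ℝ} {qA : ℕ → ℝ}
    (hEP : ∀ g ∈ W, P (E g) ∈ EvalAdm (fun k _ y => F₀ k y) (fun k _ y => ν₀ k y) (fun k _ y => w₀ k y) bg)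
    (hCP0 : 0 ≤ CPbar)
    (hLipP : ∀ g ∈ W, ∀ (U U' : Bg) (X : C.Dom),
      |P (E g) U X - P (E g) U' X| ≤ CPbar * Real.exp (-(κ * C.d X)) * gauge U U')
    (hwa : ∀ (k : ℕ) (y : ι), ∀ X ∈ F₀ k y, Integrable (fun ω => |w₀ k y X ω| * amp k y X ω) (ν₀ k y X))
    (hshift : ∀ g ∈ W, ∀ g' ∈ W, ∀ (k : ℕ) (y : ι), ∀ X ∈ F₀ k y, ∀ ω,
      gauge (bg k g y X ω) (bg k g' y X ω) ≤ amp k y X ω * |g k - g' k|)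
    (hmass : ∀ (k : ℕ) (y : ι),
      ∑ X ∈ F₀ k y, Real.exp (-(κ * C.d X)) * ∫ ω, |w₀ k y X ω| * amp k y X ω ∂(ν₀ k y X) ≤ wt k y * qA k) :
    ∀ g ∈ W, ∀ g' ∈ W, ∀ (k : ℕ) (y : ι),
      |compProj (evalChannel (fun k _ y => F₀ k y) (fun k _ y => ν₀ k y) (fun k _ y => w₀ k y) bg) P k g (E g) y -
          compProj (evalChannel (fun k _ y => F₀ k y) (fun k _ y => ν₀ k y) (fun k _ y => w₀ k y) bg) P k g' (E g) y| ≤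
        wt k y * (CPbar * qA k * |g k - g' k|) :=
  channelCouplingModulus_eval (H := fun g => P (E g)) gauge hEP hCP0 hLipP hwa hshift hmass

/-! ## §2 The read-out projection `margProj r A` -/

/-- **THE BACKGROUND MODULUS OF THE READ-OUT-PROJECTED FAMILY (kernel).**  `margProj r A (E g) U X = E g U X − r_j(E g↾j)·A U X`
(`j = scale X`): the read-out coefficient does not depend on the background, so the projected family inherits a background
modulus `CUbar + cr·Nbar·aL` from: the terms' modulus `CUbar` (`LipBackground`-type, displayed), node U2's read-out size
`ReadSize Adm r κ cr` (binder RO) applied to the size profile `TermSize E W κ N` with `N j ≤ Nbar`, and a displayed background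
modulus `aL` of the marginal direction `A` (the one-cube Wilson action is analytic, in particular Lipschitz, in the background on
the domains (1.11)–(1.14) p. 262 of [I] — elementary, with the model O-NE9-1; asserted nowhere here).
[cite: Balaban1987RG1, (1.11)-(1.14) p.262, (1.18) p.263, (1.20)-(1.22) p.264] -/
theorem lipFamily_margProj {E : Functional C Bg} {W : Set (ℕ → ℝ)} {Adm : Set (Bg → C.Dom → ℝ)}
    {r : ℕ → (Bg → C.Dom → ℝ) → ℝ} {A : Bg → C.Dom → ℝ} (gauge : Bg → Bg → ℝ)
    {κ CUbar cr aL Nbar : ℝ} {N : ℕ → ℝ}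
    (hLip : ∀ g ∈ W, ∀ (U U' : Bg) (X : C.Dom), |E g U X - E g U' X| ≤ CUbar * Real.exp (-(κ * C.d X)) * gauge U U')
    (hAdmE : ∀ g ∈ W, E g ∈ Adm) (hrs : ReadSize Adm r κ cr) (hT : TermSize E W κ N) (hN0 : ∀ j, 0 ≤ N j)
    (hNb : ∀ j, N j ≤ Nbar) (hcr : 0 ≤ cr)
    (hAL : ∀ (U U' : Bg) (X : C.Dom), |A U X - A U' X| ≤ aL * Real.exp (-(κ * C.d X)) * gauge U U') :
    ∀ g ∈ W, ∀ (U U' : Bg) (X : C.Dom),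
      |margProj r A (E g) U X - margProj r A (E g) U' X| ≤
        (CUbar + cr * Nbar * aL) * Real.exp (-(κ * C.d X)) * gauge U U' := by
  intro g hg U U' X
  set j := C.scale X with hj
  have hρ : |r j (restrictScale j (E g))| ≤ cr * N j :=
    hrs j (E g) (hAdmE g hg) (N j) (hN0 j) (fun V Y hY => by rw [← hY]; exact hT g hg V Y)
  have hρ' : |r j (restrictScale j (E g))| ≤ cr * Nbar :=
    hρ.trans (mul_le_mul_of_nonneg_left (hNb j) hcr)
  have hNbar : 0 ≤ Nbar := (hN0 0).trans (hNb 0)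
  have hsplit : margProj r A (E g) U X - margProj r A (E g) U' X =
      (E g U X - E g U' X) - r j (restrictScale j (E g)) * (A U X - A U' X) := by
    simp only [margProj, ← hj]
    ring
  rw [hsplit]
  calc |(E g U X - E g U' X) - r j (restrictScale j (E g)) * (A U X - A U' X)|
      ≤ |E g U X - E g U' X| + |r j (restrictScale j (E g)) * (A U X - A U' X)| := abs_sub _ _
    _ = |E g U X - E g U' X| + |r j (restrictScale j (E g))| * |A U X - A U' X| := by rw [abs_mul]
    _ ≤ CUbar * Real.exp (-(κ * C.d X)) * gauge U U' +
          cr * Nbar * (aL * Real.exp (-(κ * C.d X)) * gauge U U') :=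
        add_le_add (hLip g hg U U' X) (mul_le_mul hρ' (hAL U U' X) (abs_nonneg _) (mul_nonneg hcr hNbar))
    _ = (CUbar + cr * Nbar * aL) * Real.exp (-(κ * C.d X)) * gauge U U' := by ring

/-- The read-out-projected family is integrable along the evaluation families if the terms and the marginal direction are
(`w·(H − ρ·A) = w·H − ρ·(w·A)` with the background-free coefficient `ρ`). [folklore] -/
theorem evalAdm_margProj {E : Functional C Bg} {W : Set (ℕ → ℝ)} {r : ℕ → (Bg → C.Dom → ℝ) → ℝ}
    {A : Bg → C.Dom → ℝ} {F₀ : ℕ → ι → Finset C.Dom} {ν₀ : ℕ → ι → C.Dom → Measure Ω}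
    {w₀ : ℕ → ι → C.Dom → Ω → ℝ} {bg : ℕ → (ℕ → ℝ) → ι → C.Dom → Ω → Bg}
    (hE : ∀ g ∈ W, E g ∈ EvalAdm (fun k _ y => F₀ k y) (fun k _ y => ν₀ k y) (fun k _ y => w₀ k y) bg)
    (hA : A ∈ EvalAdm (fun k _ y => F₀ k y) (fun k _ y => ν₀ k y) (fun k _ y => w₀ k y) bg) :
    ∀ g ∈ W, margProj r A (E g) ∈ EvalAdm (fun k _ y => F₀ k y) (fun k _ y => ν₀ k y) (fun k _ y => w₀ k y) bg := by
  intro g hg k s y X hX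
  have h1 := (hE g hg) k s y X hX
  have h2 := (hA k s y X hX).const_mul (r (C.scale X) (restrictScale (C.scale X) (E g)))
  refine (h1.sub h2).congr (Filter.Eventually.of_forall fun ω => ?_)
  simp only [margProj, Pi.sub_apply]
  ring

/-- **`hTcup` ON THE MARGINAL-PROJECTION DICTIONARY (kernel).**  For `T := compProj (evalChannel …) (margProj r A)` (the
owner's `NE9MarginalProjectionEnd.…_margProj` face), the END's `hTcup` clause holds with
`qT k := (CUbar + cr·Nbar·aL)·qA k` from: the terms' background modulus, RO `ReadSize`, the size profile `TermSize`, the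
marginal direction's background modulus and integrability, the shift bound and the kernel shift mass.
[cite: Balaban1987RG1, (1.20)-(1.22) p.264, (2.12)-(2.13) p.268; Balaban1988RG2Cluster, (1.24) p.7] -/
theorem channelCouplingModulus_eval_margProj {E : Functional C Bg} {W : Set (ℕ → ℝ)} {Adm : Set (Bg → C.Dom → ℝ)}
    {r : ℕ → (Bg → C.Dom → ℝ) → ℝ} {A : Bg → C.Dom → ℝ}
    {F₀ : ℕ → ι → Finset C.Dom} {ν₀ : ℕ → ι → C.Dom → Measure Ω} {w₀ : ℕ → ι → C.Dom → Ω → ℝ}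
    {bg : ℕ → (ℕ → ℝ) → ι → C.Dom → Ω → Bg} (gauge : Bg → Bg → ℝ) {amp : ℕ → ι → C.Dom → Ω → ℝ}
    {κ CUbar cr aL Nbar : ℝ} {N : ℕ → ℝ} {wt : ℕ → ι → ℝ} {qA : ℕ → ℝ}
    (hE : ∀ g ∈ W, E g ∈ EvalAdm (fun k _ y => F₀ k y) (fun k _ y => ν₀ k y) (fun k _ y => w₀ k y) bg)
    (hA : A ∈ EvalAdm (fun k _ y => F₀ k y) (fun k _ y => ν₀ k y) (fun k _ y => w₀ k y) bg)
    (hCU0 : 0 ≤ CUbar)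
    (hLip : ∀ g ∈ W, ∀ (U U' : Bg) (X : C.Dom), |E g U X - E g U' X| ≤ CUbar * Real.exp (-(κ * C.d X)) * gauge U U')
    (hAdmE : ∀ g ∈ W, E g ∈ Adm) (hrs : ReadSize Adm r κ cr) (hT : TermSize E W κ N) (hN0 : ∀ j, 0 ≤ N j)
    (hNb : ∀ j, N j ≤ Nbar) (hcr : 0 ≤ cr)
    (hAL : ∀ (U U' : Bg) (X : C.Dom), |A U X - A U' X| ≤ aL * Real.exp (-(κ * C.d X)) * gauge U U')
    (haL : 0 ≤ aL)
    (hwa : ∀ (k : ℕ) (y : ι), ∀ X ∈ F₀ k y, Integrable (fun ω => |w₀ k y X ω| * amp k y X ω) (ν₀ k y X))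
    (hshift : ∀ g ∈ W, ∀ g' ∈ W, ∀ (k : ℕ) (y : ι), ∀ X ∈ F₀ k y, ∀ ω,
      gauge (bg k g y X ω) (bg k g' y X ω) ≤ amp k y X ω * |g k - g' k|)
    (hmass : ∀ (k : ℕ) (y : ι),
      ∑ X ∈ F₀ k y, Real.exp (-(κ * C.d X)) * ∫ ω, |w₀ k y X ω| * amp k y X ω ∂(ν₀ k y X) ≤ wt k y * qA k) :
    ∀ g ∈ W, ∀ g' ∈ W, ∀ (k : ℕ) (y : ι),
      |compProj (evalChannel (fun k _ y => F₀ k y) (fun k _ y => ν₀ k y) (fun k _ y => w₀ k y) bg) (margProj r A)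
            k g (E g) y -
          compProj (evalChannel (fun k _ y => F₀ k y) (fun k _ y => ν₀ k y) (fun k _ y => w₀ k y) bg) (margProj r A)
            k g' (E g) y| ≤
        wt k y * ((CUbar + cr * Nbar * aL) * qA k * |g k - g' k|) := by
  have hNbar : 0 ≤ Nbar := (hN0 0).trans (hNb 0)
  exact channelCouplingModulus_eval_compProj gauge (evalAdm_margProj hE hA) (by positivity)
    (lipFamily_margProj gauge hLip hAdmE hrs hT hN0 hNb hcr hAL) hwa hshift hmass

end Summit.QuantumFields.BalabanUV.T4Continuum.NE9EvalChannelCouplingModulusProj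

end
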